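/- Free-seat work of EXTRA WIDTH SEAT `ym-line-cbag-p1-w4` (prover-ym-line-cbag-p1-w4-g2-0), route `EguchiKawaiDirectionLadder`
(ideator ym-idea-2, LINE 8), crux `TripleSmallBallMargin` (stmt-QuantumFields-27724), toward stub (b♯) `OffBlockDecouplingRobust`
(skeleton v6): the junction of `…BlockCompression` (unitary defect of a compression, near/far label split) and `…PolarDefect`
(polar unitary + defect identity) — exactly the display of §2 of the sizing note `sizing-27724-stubB.md`.  ROUTE-INDEPENDENT.
Nothing here bears on the Yang–Mills mass gap. -/
import Summits.QuantumFields.YangMills.Theorems.EguchiKawaiDirectionLadderPolarDefect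
import HarnessLib

/-!
# Route `EguchiKawaiDirectionLadder`: a compression of a unitary = unitary + (rank ≤ near count) + (Frobenius ≤ far mass)

For `U ∈ U(N)` and a three-valued labelling `c : Fin N → Fin 3` of the indices — `c = 0` the WINDOW `I`, `c = 1` the NEAR indices
(eigenvalues within the resolution of the window's spectrum: not forced small), `c = 2` the FAR indices (forced small by entrywise
rigidity) — the compression `M = U_{II}` has unitary defect `1 − MM† = U_{I,near}U_{I,near}† + U_{I,far}U_{I,far}†`
(`one_sub_compression_gram_eq_sum`), so, when `M` is invertible, the polar/defect identity (`exists_unitary_add_lowRank_add_small`)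
gives

  `U_{II} = Θ + R + S`,  `Θ` unitary,  `rank R ≤ #near`,  `Σ|S_{ij}|² ≤ (Σ_{i∈I, j far} |U_{ij}|²)²`

(`compression_eq_unitary_add_lowRank_add_small`).  Ingredient: Frobenius submultiplicativity `Σ|(AB)_{ij}|² ≤ Σ|A_{ij}|² · Σ|B_{ij}|²`
(`sum_norm_sq_mul_le_mul`, Cauchy–Schwarz), whence `Σ|(AA†)_{ij}|² ≤ (Σ|A_{ij}|²)²`.

HONEST FRAMING: linear algebra only; the singular case `det U_{II} = 0` is not treated.  The route bears on the barrier-ledger fact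
`EguchiKawaiBreakdown` only.
-/

set_option autoImplicit false

noncomputable section

open scoped Matrix ComplexOrder Matrix.Norms.L2Operator
open Literature.Barriers.QuantumFields

namespace Summit.QuantumFields.YangMills.Theorems.EguchiKawaiDirectionLadder

/-! ### §1 Frobenius submultiplicativity (explicit sums) -/

section Frob

variable {l m n : Type*} [Fintype l] [Fintype m] [Fintype n]

/-- **Frobenius submultiplicativity**: `Σ_{ij}|(AB)_{ij}|² ≤ (Σ_{il}|A_{il}|²)·(Σ_{lj}|B_{lj}|²)` (Cauchy–Schwarz in the inner index). -/
theorem sum_norm_sq_mul_le_mul (A : Matrix l m ℂ) (B : Matrix m n ℂ) :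
    ∑ i, ∑ j, ‖(A * B) i j‖ ^ 2 ≤ (∑ i, ∑ l, ‖A i l‖ ^ 2) * ∑ l, ∑ j, ‖B l j‖ ^ 2 := by
  have hentry : ∀ i j, ‖(A * B) i j‖ ^ 2 ≤ (∑ l, ‖A i l‖ ^ 2) * ∑ l, ‖B l j‖ ^ 2 := by
    intro i j
    have h1 : ‖(A * B) i j‖ ≤ ∑ l, ‖A i l‖ * ‖B l j‖ := by
      rw [Matrix.mul_apply]
      exact (norm_sum_le _ _).trans (Finset.sum_le_sum fun l _ => (norm_mul_le _ _))
    have h0 : 0 ≤ ‖(A * B) i j‖ := norm_nonneg _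
    calc ‖(A * B) i j‖ ^ 2 ≤ (∑ l, ‖A i l‖ * ‖B l j‖) ^ 2 := pow_le_pow_left₀ h0 h1 2
      _ ≤ (∑ l, ‖A i l‖ ^ 2) * ∑ l, ‖B l j‖ ^ 2 := Finset.sum_mul_sq_le_sq_mul_sq _ _ _
  calc ∑ i, ∑ j, ‖(A * B) i j‖ ^ 2 ≤ ∑ i, ∑ j, (∑ l, ‖A i l‖ ^ 2) * ∑ l, ‖B l j‖ ^ 2 :=
        Finset.sum_le_sum fun i _ => Finset.sum_le_sum fun j _ => hentry i j
    _ = (∑ i, ∑ l, ‖A i l‖ ^ 2) * ∑ j, ∑ l, ‖B l j‖ ^ 2 := by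
        rw [Finset.sum_mul_sum]
    _ = (∑ i, ∑ l, ‖A i l‖ ^ 2) * ∑ l, ∑ j, ‖B l j‖ ^ 2 := by rw [Finset.sum_comm (f := fun j l => ‖B l j‖ ^ 2)]

/-- `Σ|(A A†)_{ij}|² ≤ (Σ|A_{ij}|²)²`. -/
theorem sum_norm_sq_mul_conjTranspose_le_sq (A : Matrix l m ℂ) :
    ∑ i, ∑ j, ‖(A * Aᴴ) i j‖ ^ 2 ≤ (∑ i, ∑ j, ‖A i j‖ ^ 2) ^ 2 := by
  have h := sum_norm_sq_mul_le_mul A Aᴴ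
  have hH : ∑ l, ∑ j, ‖Aᴴ l j‖ ^ 2 = ∑ i, ∑ j, ‖A i j‖ ^ 2 := by
    rw [Finset.sum_comm]
    simp [Matrix.conjTranspose_apply]
  rw [hH] at h
  rw [sq]
  exact h

end Frob

/-! ### §2 The near/far split of a compression -/

section Split

variable {N : ℕ}

/-- **A compression of a unitary is unitary + low rank + small.**  For `U ∈ U(N)`, a labelling `c : Fin N → Fin 3`
(`0` = window, `1` = near, `2` = far) and an invertible compression `U_{II}` (`I = {c = 0}`):
`U_{II} = Θ + R + S` with `Θ` unitary, `rank R ≤ #{c = 1}` and `Σ|S_{ij}|² ≤ (Σ_{i ∈ I, c j = 2} |U_{ij}|²)²`. -/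
theorem compression_eq_unitary_add_lowRank_add_small (U : UN N) (c : Fin N → Fin 3)
    (hU : IsUnit ((U : Matrix (Fin N) (Fin N) ℂ).toBlock (fun j => c j = 0) (fun j => c j = 0))) :
    ∃ Θ R S : Matrix {j : Fin N // c j = 0} {j : Fin N // c j = 0} ℂ,
      Θ ∈ Matrix.unitaryGroup {j : Fin N // c j = 0} ℂ ∧
        R.rank ≤ Fintype.card {j : Fin N // c j = 1} ∧
          ∑ i, ∑ j, ‖S i j‖ ^ 2 ≤
            (∑ i, ∑ j, ‖(U : Matrix (Fin N) (Fin N) ℂ).toBlock (fun j => c j = 0) (fun j => c j = 2) i j‖ ^ 2) ^ 2 ∧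
          (U : Matrix (Fin N) (Fin N) ℂ).toBlock (fun j => c j = 0) (fun j => c j = 0) = Θ + R + S := by
  -- the defect split `1 − MM† = D_near + D_far`
  set M := (U : Matrix (Fin N) (Fin N) ℂ).toBlock (fun j => c j = 0) (fun j => c j = 0) with hM
  set A₁ := (U : Matrix (Fin N) (Fin N) ℂ).toBlock (fun j => c j = 0) (fun j => c j = 1) with hA₁
  set A₂ := (U : Matrix (Fin N) (Fin N) ℂ).toBlock (fun j => c j = 0) (fun j => c j = 2) with hA₂
  have hsplit : 1 - M * Mᴴ = A₁ * A₁ᴴ + A₂ * A₂ᴴ := by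
    have h := one_sub_compression_gram_eq_sum U c 0
    rw [h]
    have huniv : (Finset.univ : Finset (Fin 3)).erase 0 = {1, 2} := by decide
    rw [huniv, Finset.sum_pair (by decide)]
  obtain ⟨Θ, R, S, hΘ, hR, hS, hMeq⟩ := exists_unitary_add_lowRank_add_small M (A₁ * A₁ᴴ) (A₂ * A₂ᴴ) hU hsplit
  refine ⟨Θ, R, S, hΘ, hR.trans (rank_mul_conjTranspose_le_card A₁), hS.trans (sum_norm_sq_mul_conjTranspose_le_sq A₂),
    hMeq⟩

end Split

end Summit.QuantumFields.YangMills.Theorems.EguchiKawaiDirectionLadder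

end
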